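import Mathlib
import HarnessLib

/-!
# [OURS · L1 W4.5(b) · EL♮(3) · D6 HSUBᵉ, brick (FI) «fibre-integral transport», LOCAL KERNEL] A NOETHERIAN LOCAL RING WHOSE REDUCTION
# MODULO A REGULAR PARAMETER IS A DOMAIN (resp. REDUCED) IS A DOMAIN (resp. REDUCED)

res-L1-w45b-stub-4 g12 (free pen after ✓ p677149; res-L1-w45b-idea-3's (FI) l.84158: «X → Spec O flat + proper, special fibre reduced and
irreducible ⇒ X integral», whose local kernel this is). Crux `EquisingularLiftNatThree` = stmt-ResolutionOfSingularities-20148 (parent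
stmt-…-20038), route `EquisingularLift`, line `sections`. OURS — folklore commutative algebra, NOT a statement of any manuscript
([Hironaka2017] is a candidate under adjudication; nothing of it is asserted); AI-written, weaker than expert review. No `sorry`, no definition,
no instance; `import Mathlib` only; standard axioms. `--supports stmt-ResolutionOfSingularities-20148 --as helper`.

WHAT. `B` a noetherian local ring, `ϖ ∈ 𝔪_B` a non-zero-divisor (for a scheme flat over a DVR `O` with uniformiser `ϖ`, every local ring at a
point of the special fibre is such a `B`, and `B ⧸ (ϖ)` is the local ring of the special fibre):
* `exists_eq_pow_mul_not_mem` — every `x ≠ 0` is `ϖⁿ · x'` with `x' ∉ (ϖ)` (Krull's intersection theorem `⨅ₙ (ϖ)ⁿ = ⊥`,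
  Mathlib `Ideal.iInf_pow_eq_bot_of_isLocalRing`, and `(ϖ)ⁿ = (ϖⁿ)`);
* ★ `isDomain_of_isDomain_quotient` — if `B ⧸ (ϖ)` is a domain then so is `B` (`xy = ϖⁿ⁺ᵐ·x'y'` with `x'y' ∉ (ϖ)` by primality, non-zero
  because `ϖⁿ⁺ᵐ` is a non-zero-divisor);
* ★ `isReduced_of_isReduced_quotient` — if `B ⧸ (ϖ)` is reduced then so is `B` (`x = ϖⁿ·x'` nilpotent forces `x'` nilpotent, hence
  `x' ∈ (ϖ)` by reducedness of the quotient).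
* `isDomain_of_ker_eq_span_singleton` / `isReduced_of_ker_eq_span_singleton` — the same with the hypothesis in STALK-SQUARE form: a ring
  map `ψ : B → A` to a domain (resp. reduced ring) with `ker ψ = (ϖ)` (no surjectivity needed).
No Nakayama and no minimal primes are used. (The hypothesis `ϖ ∈ 𝔪_B` cannot be dropped: for a unit `ϖ` the quotient is `0`.)

References: H. Matsumura, *Commutative Ring Theory* (1986), Thm. 8.10 (Krull) and §14 [Matsumura1987]; W. Bruns–J. Herzog, *Cohen–Macaulay
rings* (1993), proof of Prop. 2.2.4 (the same factorisation argument) — folklore.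
-/

set_option linter.dupNamespace false -- mandated namespace `Summit.<Summit>.<Problem>` of this single-conjunct summit

namespace Summit.ResolutionOfSingularities.ResolutionOfSingularities.Cruxes.EquisingularLiftNat.Sections

namespace FibreIntegral

variable {B : Type*} [CommRing B] [IsNoetherianRing B] [IsLocalRing B] {ϖ : B}

/-- **`ϖ`-adic factorisation in a noetherian local ring**: if `ϖ ∈ 𝔪_B`, every `x ≠ 0` is `ϖⁿ · x'` with `x' ∉ (ϖ)`
(Krull's intersection theorem). [cite: Matsumura1987, Thm. 8.10] -/
theorem exists_eq_pow_mul_not_mem (hϖ : ϖ ∈ IsLocalRing.maximalIdeal B) {x : B} (hx : x ≠ 0) :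
    ∃ (n : ℕ) (x' : B), x = ϖ ^ n * x' ∧ x' ∉ Ideal.span {ϖ} := by
  classical
  have htop : Ideal.span {ϖ} ≠ ⊤ :=
    ne_top_of_le_ne_top (IsLocalRing.maximalIdeal.isMaximal B).ne_top
      ((Ideal.span_singleton_le_iff_mem _).mpr hϖ)
  have hex : ∃ n : ℕ, x ∉ Ideal.span {ϖ} ^ n := by
    by_contra h
    push Not at h
    apply hx
    have hmem : x ∈ ⨅ n : ℕ, Ideal.span {ϖ} ^ n := Ideal.mem_iInf.mpr h
    rwa [Ideal.iInf_pow_eq_bot_of_isLocalRing _ htop, Ideal.mem_bot] at hmem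
  obtain ⟨m, hm, hmin⟩ : ∃ m : ℕ, x ∉ Ideal.span {ϖ} ^ m ∧ ∀ j < m, x ∈ Ideal.span {ϖ} ^ j :=
    ⟨Nat.find hex, Nat.find_spec hex, fun j hj => not_not.mp (Nat.find_min hex hj)⟩
  have hm0 : m ≠ 0 := by
    rintro rfl
    exact hm (by rw [pow_zero, Ideal.one_eq_top]; exact Submodule.mem_top)
  obtain ⟨n, rfl⟩ : ∃ n, m = n + 1 := Nat.exists_eq_succ_of_ne_zero hm0
  have hxn : x ∈ Ideal.span {ϖ} ^ n := hmin n (Nat.lt_succ_self n)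
  rw [Ideal.span_singleton_pow, Ideal.mem_span_singleton] at hxn
  obtain ⟨x', hx'⟩ := hxn
  refine ⟨n, x', hx', fun hx'mem => hm ?_⟩
  obtain ⟨c, hc⟩ := Ideal.mem_span_singleton.mp hx'mem
  rw [Ideal.span_singleton_pow, Ideal.mem_span_singleton]
  exact ⟨c, by rw [hx', hc]; ring⟩

/-- ★ **A noetherian local ring is a domain if its reduction modulo a regular parameter is**: `ϖ ∈ 𝔪_B` a non-zero-divisor and
`B ⧸ (ϖ)` a domain ⇒ `B` a domain. [cite: Matsumura1987, Thm. 8.10] -/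
theorem isDomain_of_isDomain_quotient (hϖ : ϖ ∈ IsLocalRing.maximalIdeal B) (hreg : ϖ ∈ nonZeroDivisors B)
    (hdom : IsDomain (B ⧸ Ideal.span {ϖ})) : IsDomain B := by
  have hP : (Ideal.span {ϖ}).IsPrime := (Ideal.Quotient.isDomain_iff_prime _).mp hdom
  haveI : NoZeroDivisors B := ⟨fun {x y} hxy => by
    by_contra h
    obtain ⟨hx, hy⟩ := not_or.mp h
    obtain ⟨n, x', rfl, hx'⟩ := exists_eq_pow_mul_not_mem hϖ hx
    obtain ⟨m, y', rfl, hy'⟩ := exists_eq_pow_mul_not_mem hϖ hy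
    have hprod : x' * y' ∉ Ideal.span {ϖ} := fun hmem => (hP.mem_or_mem hmem).elim hx' hy'
    have hzero : ϖ ^ (n + m) * (x' * y') = 0 := by rw [← hxy]; ring
    rw [mul_left_mem_nonZeroDivisors_eq_zero_iff (pow_mem hreg (n + m))] at hzero
    exact hprod (hzero ▸ Ideal.zero_mem _)⟩
  exact NoZeroDivisors.to_isDomain B

/-- ★ **A noetherian local ring is reduced if its reduction modulo a regular parameter is**: `ϖ ∈ 𝔪_B` a non-zero-divisor and
`B ⧸ (ϖ)` reduced ⇒ `B` reduced. [cite: Matsumura1987, Thm. 8.10] -/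
theorem isReduced_of_isReduced_quotient (hϖ : ϖ ∈ IsLocalRing.maximalIdeal B) (hreg : ϖ ∈ nonZeroDivisors B)
    (hred : IsReduced (B ⧸ Ideal.span {ϖ})) : IsReduced B := by
  refine ⟨fun x hxnil => ?_⟩
  by_contra hx
  obtain ⟨n, x', rfl, hx'⟩ := exists_eq_pow_mul_not_mem hϖ hx
  obtain ⟨N, hN⟩ := hxnil
  -- `x'` is nilpotent: `ϖ^{nN} · x'^N = 0` and `ϖ^{nN}` is a non-zero-divisor
  have hx'N : x' ^ N = 0 := by
    have h : ϖ ^ (n * N) * x' ^ N = 0 := by rw [← hN]; ring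
    rwa [mul_left_mem_nonZeroDivisors_eq_zero_iff (pow_mem hreg (n * N))] at h
  -- hence its image in the reduced ring `B ⧸ (ϖ)` vanishes, i.e. `x' ∈ (ϖ)`
  apply hx'
  rw [← Ideal.Quotient.eq_zero_iff_mem]
  exact hred.eq_zero _ ⟨N, by rw [← map_pow, hx'N, map_zero]⟩

/-- **Stalk-square form of `isDomain_of_isDomain_quotient`**: if some ring map `ψ : B → A` to a DOMAIN has kernel exactly `(ϖ)` (for a
scheme flat over a DVR: `ψ` = the stalk map of the special-fibre inclusion at a point where the fibre is integral), then `B` is a domain.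
[cite: Matsumura1987, Thm. 8.10] -/
theorem isDomain_of_ker_eq_span_singleton {A : Type*} [CommRing A] [IsDomain A] (ψ : B →+* A)
    (hker : RingHom.ker ψ = Ideal.span {ϖ}) (hϖ : ϖ ∈ IsLocalRing.maximalIdeal B) (hreg : ϖ ∈ nonZeroDivisors B) :
    IsDomain B :=
  isDomain_of_isDomain_quotient hϖ hreg ((Ideal.Quotient.isDomain_iff_prime _).mpr (hker ▸ RingHom.ker_isPrime ψ))

/-- **Stalk-square form of `isReduced_of_isReduced_quotient`**: if some ring map `ψ : B → A` to a REDUCED ring has kernel exactly `(ϖ)`,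
then `B` is reduced. [cite: Matsumura1987, Thm. 8.10] -/
theorem isReduced_of_ker_eq_span_singleton {A : Type*} [CommRing A] [IsReduced A] (ψ : B →+* A)
    (hker : RingHom.ker ψ = Ideal.span {ϖ}) (hϖ : ϖ ∈ IsLocalRing.maximalIdeal B) (hreg : ϖ ∈ nonZeroDivisors B) :
    IsReduced B := by
  refine isReduced_of_isReduced_quotient hϖ hreg ((Ideal.isRadical_iff_quotient_reduced _).mp ?_)
  rw [← hker]
  rintro x ⟨n, hn⟩
  rw [RingHom.mem_ker, map_pow] at hn
  exact (RingHom.mem_ker).mpr (IsReduced.eq_zero _ ⟨n, hn⟩)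

end FibreIntegral

end Summit.ResolutionOfSingularities.ResolutionOfSingularities.Cruxes.EquisingularLiftNat.Sections
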